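import Summits.Ventures.Crystal3D.Theorems.StickyWulffConstantCoaxialWallLawSeamGlideCensusSound
import HarnessLib

/-!
# GLIDE-CENSUS SOUNDNESS, part B: model symmetries, the twin dozen of the end ball, the vacancy / hex-vacancy / hex-blocked leaves
# (crux `CoaxialWallLaw`, stmt-Ventures-19481; lane F 'Certificates' v8.7, registered stub `stub_satCensus11Glide : TailResidue.SatCensus11Glide`)

HONEST FRAMING. Venture `Summits/Ventures/Crystal3D` (cell `crystal3d-full`); helper for `stub_satCensus11Glide`; sequel of '…SeamGlideCensusSound' (seat 19481-p2 g16).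
* `toV_msymQ`, `TT_add_msymQ` — the checker's rational reflection chains act on model balls through the model isometries `Msym` of '…SeamFullCensusCert';
* `twin_table`, `TT_btw` — the checker's twin dozen of the end ball is `TT bG + A₀ (twinSite l)` for the frame `A₀ = Cc ≫ Qr ≫ G'`;
* **`false_of_vacG`** (eleven twin slots present ⇒ `two_unsaturated_of_twinVacancyShell` contradicts «at most one unsaturated contact»),
  **`false_of_hvG`** (the ¼-hole `quarter_le_dist_dozenVacancy` at the vacant slot + `HexVacancyCap = CapRow T6` at the saturated hexagon ball: it would have
  at most eleven contacts), **`false_of_pocketG`** (an undecided contact of the end ball exists, is saturated, and is a pocket ball of the template: `GlidePocketCap`);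
* **`runG_sound`** — soundness of the checker by induction on the certificate.
WHAT THIS IS NOT: no certificate is checked here; the inputs stay named; F-C1 not moved.
-/

noncomputable section

namespace Summit.Ventures.Crystal3D.Theorems

namespace TailResidue

namespace GlideCensus

open Summit.Ventures.Crystal3D Finset EndRowFloor NearIdentity FullCensus
open scoped InnerProductSpace

variable {X : Finset (EuclideanSpace ℝ (Fin 3))} {G' : EuclideanSpace ℝ (Fin 3) ≃ₗᵢ[ℝ] EuclideanSpace ℝ (Fin 3)} {q₀ : EuclideanSpace ℝ (Fin 3)}

attribute [local irreducible] insertV addAll fullList ownList mirList farList tabs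

/-! ### §5 Rational reflection chains -/

/-- `reflQ` is `reflV` on `toV`. -/
theorem toV_reflQ (n v : Q3) : (reflQ n v).toV = reflV n.toV v.toV := by
  rw [reflQ, reflV, Q3.toV_sub, Q3.toV_smul, Q3.dq_toV, Q3.dq_toV]

/-- `msymQ` is `msym` on `toV`. -/
theorem toV_msymQ : ∀ (ns : List Q3) (v : Q3), (msymQ ns v).toV = msym (ns.map Q3.toV) v.toV := by
  intro ns
  induction ns with
  | nil => intro v; rfl
  | cons n ns ih => intro v; show (msymQ ns (reflQ n v)).toV = msym (ns.map Q3.toV) (reflV n.toV v.toV); rw [ih, toV_reflQ]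

/-- The model isometry of a chain. -/
def MsymQ (ns : List Q3) : EuclideanSpace ℝ (Fin 3) ≃ₗᵢ[ℝ] EuclideanSpace ℝ (Fin 3) := Msym (ns.map Q3.toV)

/-- Non-degeneracy of the chain, in the checker's form, gives it in `msym`'s form. -/
theorem nondeg_of_all {ns : List Q3} (h : (ns.all fun n => !decide (Q3.dot n n = 0)) = true) : ∀ n ∈ ns.map Q3.toV, dq n n ≠ 0 := by
  intro n hn
  obtain ⟨m, hm, rfl⟩ := List.mem_map.1 hn
  rw [Q3.dq_toV]
  simp only [List.all_eq_true, Bool.not_eq_true', decide_eq_false_iff_not] at h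
  exact h m hm

/-- `MsymQ` acts on model balls by `msymQ`. -/
theorem MsymQ_iptQ {ns : List Q3} (h : (ns.all fun n => !decide (Q3.dot n n = 0)) = true) (v : Q3) : MsymQ ns (iptQ v.toV) = iptQ (msymQ ns v).toV := by
  rw [MsymQ, Msym_iptQ _ (nondeg_of_all h), toV_msymQ]

/-- The configuration isometry of a chain: `Qr⁻¹`, the chain, `Qr`, then `G'`. -/
def AofChain (G' : EuclideanSpace ℝ (Fin 3) ≃ₗᵢ[ℝ] EuclideanSpace ℝ (Fin 3)) (ns : List Q3) : EuclideanSpace ℝ (Fin 3) ≃ₗᵢ[ℝ] EuclideanSpace ℝ (Fin 3) :=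
  (Qr.symm.trans ((MsymQ ns).trans Qr)).trans G'

/-- Placing a template vector by the chain isometry lands on the model ball. -/
theorem TT_add_msymQ {ns : List Q3} (h : (ns.all fun n => !decide (Q3.dot n n = 0)) = true) (y v : Q3) :
    TT G' q₀ y + AofChain G' ns (Qr (iptQ v.toV)) = TT G' q₀ (Q3.add y (msymQ ns v)) := by
  rw [TT_add, AofChain, LinearIsometryEquiv.trans_apply, LinearIsometryEquiv.trans_apply, LinearIsometryEquiv.trans_apply, LinearIsometryEquiv.symm_apply_apply,
    MsymQ_iptQ h]

/-! ### §6 The twin dozen of the end ball -/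

/-- The twin frame of the configuration: cubic coordinates, the tilt, the reading. -/
def A₀ (G' : EuclideanSpace ℝ (Fin 3) ≃ₗᵢ[ℝ] EuclideanSpace ℝ (Fin 3)) : EuclideanSpace ℝ (Fin 3) ≃ₗᵢ[ℝ] EuclideanSpace ℝ (Fin 3) := Cc.trans (Qr.trans G')

/-- Table: the checker's twin list and neighbour list are `twinInt` / `twinNbr`; the twelve slots are distinct contacts of `bG`; a fourth neighbour index exists. -/
theorem twin_table :
    (∀ l : Fin 12, twinL.getD l ⟨0, 0, 0⟩ = twinQ3 l) ∧ (∀ k : Fin 12, ∀ m : Fin 4, nbt k m = (twinNbr k m : ℕ)) ∧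
    ((List.finRange 12).map fun l : Fin 12 => Q3.add bG (twinQ3 l)).Nodup ∧ (∀ l : Fin 12, Q3.d2 bG (Q3.add bG (twinQ3 l)) = 18) ∧
    (∀ i j l : Fin 4, i ≠ j → i ≠ l → j ≠ l → ∃ o : Fin 4, o ≠ i ∧ o ≠ j ∧ o ≠ l) := by
  refine ⟨by decide +kernel, by decide +kernel, by decide +kernel, by decide +kernel, by decide⟩

/-- `btw l` is `bG + twinQ3 l`. -/
theorem btw_eq (l : Fin 12) : btw l = Q3.add bG (twinQ3 l) := by
  rw [btw, twin_table.1 l]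

/-- The checker's twin slots are the twin dozen of the end ball in the frame `A₀`. -/
theorem TT_btw (l : Fin 12) : TT G' q₀ bG + A₀ G' (twinSite l) = TT G' q₀ (btw l) := by
  rw [btw_eq, A₀, LinearIsometryEquiv.trans_apply, LinearIsometryEquiv.trans_apply, Cc_twinSite, TT_add]

/-- Neighbour slots. -/
theorem TT_btw_nbr (k : Fin 12) (m : Fin 4) : TT G' q₀ bG + A₀ G' (twinSite (twinNbr k m)) = TT G' q₀ (btw (nbt k m)) := by
  rw [TT_btw, twin_table.2.1 k m]

open scoped Classical in
/-- A twin slot of the end ball cannot be a twelfth contact: if the other eleven are present, slot `k` is absent. -/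
theorem btw_notMem (hyp : HypG X G' q₀) (k : Fin 12) (hocc : ∀ l : Fin 12, l ≠ k → TT G' q₀ (btw l) ∈ X) :
    TT G' q₀ (btw k) ∉ X := by
  intro hk
  obtain ⟨-, -, hnd, hcontact, -⟩ := twin_table
  refine false_of_twelve_contacts G' q₀ (((List.finRange 12).map fun l : Fin 12 => Q3.add bG (twinQ3 l)).map Q3.toV)
    ((List.nodup_map_iff Q3.toV_injective).2 hnd) (by simp) (fun v hv => ?_) (fun v hv => ?_) hyp.deg
  · rw [List.mem_map] at hv
    obtain ⟨p, hp, rfl⟩ := hv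
    rw [List.mem_map] at hp
    obtain ⟨l, -, rfl⟩ := hp
    rw [← btw_eq]
    by_cases hl : l = k
    · rw [hl]; exact hk
    · exact hocc l hl
  · rw [List.mem_map] at hv
    obtain ⟨p, hp, rfl⟩ := hv
    rw [List.mem_map] at hp
    obtain ⟨l, -, rfl⟩ := hp
    rw [Q3.dq_toV_sub]; exact hcontact l

/-! ### §7 The vacancy leaf -/

/-- **THE TWIN-VACANCY LEAF.** -/
theorem false_of_vacG (hyp : HypG X G' q₀) {st : St} (hinv : InvG X G' q₀ st) {k : ℕ} (h : runG (.vac k) st = true) : False := by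
  simp only [runG, Bool.and_eq_true, decide_eq_true_eq, List.all_eq_true, List.mem_range, Bool.or_eq_true] at h
  obtain ⟨hk, hall⟩ := h
  have hocc : ∀ l : Fin 12, l ≠ (⟨k, hk⟩ : Fin 12) → TT G' q₀ (btw l) ∈ X := by
    intro l hl
    rcases hall l l.2 with h | h
    · exact absurd (Fin.ext h) hl
    · exact hinv.pres _ h
  have hvac := btw_notMem hyp ⟨k, hk⟩ hocc
  have hocc' : ∀ l : Fin 12, l ≠ (⟨k, hk⟩ : Fin 12) → TT G' q₀ bG + A₀ G' (twinSite l) ∈ X := fun l hl => by rw [TT_btw]; exact hocc l hl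
  have hvac' : TT G' q₀ bG + A₀ G' (twinSite ⟨k, hk⟩) ∉ X := by rw [TT_btw]; exact hvac
  obtain ⟨y, hy, y', hy', hne, hd, hd', hc, hc'⟩ := two_unsaturated_of_twinVacancyShell hyp.gap hyp.cap hyp.sep (A₀ G') hyp.bmem hocc' hvac'
  exact hne (hyp.one y hy y' hy' hd hd' hc hc')

/-! ### §8 The hex-vacancy leaf -/

/-- Table: the template contacts are six distinct unit model vectors. -/
theorem c6_table : (∀ a : Fin 6, Q3.dot (c6 a) (c6 a) = 18) ∧ ∀ a a' : Fin 6, c6 (a : ℕ) = c6 (a' : ℕ) → a = a' := by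
  refine ⟨by decide +kernel, by decide +kernel⟩

/-- The template contacts have norm one. -/
theorem norm_T6c (a : Fin 6) : ‖T6.c a‖ = 1 := by
  show ‖Qr (iptQ (c6 a).toV)‖ = 1
  rw [LinearIsometryEquiv.norm_map]
  have h : ⟪iptQ (c6 a).toV, iptQ (c6 a).toV⟫_ℝ = 1 := by
    rw [inner_iptQ, Q3.dq_toV, c6_table.1 a]; norm_num
  have h2 : ‖iptQ (c6 a).toV‖ ^ 2 = 1 := by rw [← real_inner_self_eq_norm_sq]; exact h
  nlinarith [norm_nonneg (iptQ (c6 a).toV), h2]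

/-- The template contacts are pairwise distinct. -/
theorem T6c_injective : Function.Injective T6.c := by
  intro a a' h
  exact c6_table.2 a a' (Q3.toV_injective (iptQ_injective (Qr.injective h)))

open scoped Classical in
/-- **THE HEX-VACANCY LEAF.** -/
theorem false_of_hvG (hyp : HypG X G' q₀) {st : St} (hinv : InvG X G' q₀ st) {k i j l : ℕ} {y : Q3} {ns : List Q3}
    (h : runG (.hv k i j l y ns) st = true) : False := by
  simp only [runG, Bool.and_eq_true, decide_eq_true_eq, Bool.not_eq_true', decide_eq_false_iff_not, List.all_eq_true] at h
  obtain ⟨⟨⟨⟨⟨⟨⟨⟨⟨⟨⟨⟨⟨⟨hk, hi⟩, hj⟩, hl⟩, hij⟩, hil⟩, hjl⟩, hemp⟩, hsi⟩, hsj⟩, hsl⟩, hy⟩, hns⟩, hpres⟩, hhole⟩ := h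
  have hns' : (ns.all fun n => !decide (Q3.dot n n = 0)) = true := by
    simp only [List.all_eq_true, Bool.not_eq_true', decide_eq_false_iff_not]; exact hns
  set kk : Fin 12 := ⟨k, hk⟩
  set ii : Fin 4 := ⟨i, hi⟩
  set jj : Fin 4 := ⟨j, hj⟩
  set ll : Fin 4 := ⟨l, hl⟩
  -- the quarter hole at the vacant slot
  have hvac : TT G' q₀ bG + A₀ G' (twinSite kk) ∉ X := by rw [TT_btw]; exact hinv.emp _ hemp
  have hsat3 : ∀ m ∈ ({ii, jj, ll} : Finset (Fin 4)), TT G' q₀ bG + A₀ G' (twinSite (twinNbr kk m)) ∈ X ∧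
      (X.filter fun z => dist (TT G' q₀ bG + A₀ G' (twinSite (twinNbr kk m))) z = 1).card = 12 := by
    intro m hm
    rw [TT_btw_nbr]
    simp only [mem_insert, mem_singleton] at hm
    rcases hm with rfl | rfl | rfl
    · exact hinv.sat _ hsi
    · exact hinv.sat _ hsj
    · exact hinv.sat _ hsl
  have hij' : ii ≠ jj := fun h => hij (by simpa [kk, ii, jj] using congrArg Fin.val h)
  have hil' : ii ≠ ll := fun h => hil (by simpa [ii, ll] using congrArg Fin.val h)
  have hjl' : jj ≠ ll := fun h => hjl (by simpa [jj, ll] using congrArg Fin.val h)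
  obtain ⟨o, hoi, hoj, hol⟩ := twin_table.2.2.2.2 ii jj ll hij' hil' hjl'
  have hole : ∀ x ∈ X, 1 / 4 ≤ dist x (TT G' q₀ bG + A₀ G' (twinSite kk)) := fun x hx =>
    quarter_le_dist_dozenVacancy hyp.gap isDozenFrame_twin hyp.sep (A₀ G') (TT G' q₀ bG) hvac hij' hil' hjl' ⟨o, hoi, hoj, hol⟩ hsat3 hx
  -- the template at `y`
  obtain ⟨hyX, hy12⟩ := hinv.sat y hy
  have hc : ∀ a : Fin 6, TT G' q₀ y + AofChain G' ns (T6.c a) ∈ X := by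
    intro a
    show TT G' q₀ y + AofChain G' ns (Qr (iptQ (c6 (a : ℕ)).toV)) ∈ X
    rw [TT_add_msymQ hns']
    exact hinv.pres _ (hpres a (List.mem_range.2 a.2))
  have ho' : ∀ x ∈ X, dist x (TT G' q₀ y) = 1 → (∀ a, x ≠ TT G' q₀ y + AofChain G' ns (T6.c a)) →
      ∀ jj : Fin 1, T6.r jj ≤ dist x (TT G' q₀ y + AofChain G' ns (T6.o jj)) := by
    intro x hx _ _ jj
    show (1 : ℝ) / 4 ≤ dist x (TT G' q₀ y + AofChain G' ns (Qr (iptQ v6.toV)))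
    rw [TT_add_msymQ hns', hhole]
    have h' := hole x hx
    rw [TT_btw] at h'
    exact h'
  have hle := card_contacts_le_eleven_of_capRow hyp.hex hyp.sep (AofChain G' ns) norm_T6c T6c_injective hc ho'
  omega

/-- The contacts of `T6b` are those of `T6`. -/
theorem norm_T6bc (a : Fin 6) : ‖T6b.c a‖ = 1 := norm_T6c a

/-- The contacts of `T6b` are pairwise distinct. -/
theorem T6bc_injective : Function.Injective T6b.c := T6c_injective

/-- **THE HEX-BLOCKED LEAF**: `HexBlockedCap = CapRow T6b` at the saturated hexagon ball whose vacancy refill is blocked by a present pocket ball. -/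
theorem false_of_hbG (hyp : HypG X G' q₀) {st : St} (hinv : InvG X G' q₀ st) {y : Q3} {ns : List Q3} (h : runG (.hb y ns) st = true) : False := by
  classical
  simp only [runG, Bool.and_eq_true, decide_eq_true_eq, Bool.not_eq_true', decide_eq_false_iff_not, List.all_eq_true, List.mem_range] at h
  obtain ⟨⟨⟨⟨hy, hns⟩, hpres⟩, hB⟩, hBd⟩ := h
  have hns' : (ns.all fun n => !decide (Q3.dot n n = 0)) = true := by
    simp only [List.all_eq_true, Bool.not_eq_true', decide_eq_false_iff_not]; exact hns
  obtain ⟨hyX, hy12⟩ := hinv.sat y hy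
  have hc : ∀ a : Fin 6, TT G' q₀ y + AofChain G' ns (T6b.c a) ∈ X := by
    intro a
    show TT G' q₀ y + AofChain G' ns (Qr (iptQ (c6 (a : ℕ)).toV)) ∈ X
    rw [TT_add_msymQ hns']
    exact hinv.pres _ (hpres a a.2)
  have hBX : TT G' q₀ (Q3.add y (msymQ ns o6)) ∈ X := hinv.pres _ hB
  have hBy : dist (TT G' q₀ (Q3.add y (msymQ ns o6))) (TT G' q₀ y) ≠ 1 := fun h => hBd ((dist_TT_eq_one_iff G' q₀ _ _).1 h)
  have ho' : ∀ x ∈ X, dist x (TT G' q₀ y) = 1 → (∀ a, x ≠ TT G' q₀ y + AofChain G' ns (T6b.c a)) →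
      ∀ jj : Fin 1, T6b.r jj ≤ dist x (TT G' q₀ y + AofChain G' ns (T6b.o jj)) := by
    intro x hx hxy _ jj
    show (1 : ℝ) ≤ dist x (TT G' q₀ y + AofChain G' ns (Qr (iptQ o6.toV)))
    rw [TT_add_msymQ hns']
    exact le_dist_of_present_obstacle hyp.sep hBX hBy hx hxy
  have hle := card_contacts_le_eleven_of_capRow hyp.hexb hyp.sep (AofChain G' ns) norm_T6bc T6bc_injective hc ho'
  omega

end GlideCensus

end TailResidue

end Summit.Ventures.Crystal3D.Theorems

end
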